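import Literature.AnabelianGeometry.AbsoluteAnabelian.AbsTopI.CoFreeCompletion
import HarnessLib

/-!
# [AbsTopI] §0 p. 8: neighbourhoods in the `(Q, Δ)`-co-free completion (v2 topology)

Companion to `AbsTopI/CoFreeCompletion.lean` (v2, cell erratum E-L4-7): the topology of
`Π^{Q/co-fr} = lim_H Im_Q(Π/H^{co-fr})` is the inverse limit of the QUOTIENT topologies of the
`Π ⧸ K_H` (`K_H := Ker(Π → Q ⧸ Ĥ^{co-fr}_Q)`), i.e. the initial topology of the coordinate maps
`kerCoord H`.  This file records the transition maps `Π ⧸ K_{H'} → Π ⧸ K_H` (`H' ⊆ H`), the formula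
`𝓝 x = ⨅_H (kerCoord H)⁻¹ 𝓝(kerCoord H x)`, the DIRECTEDNESS of that family along the index
semilattice, and the resulting membership criterion `mem_nhds_iff` — the tool for the density of
`Π → Π^{Q/co-fr}` (`CoFreeCompletionDense.lean`).  General topology over [AbsTopI] §0 p. 8
([cite: MochizukiAbsTopI2012, §0 p.8]); asserts nothing about [IUTchIII] Cor 3.12.
-/

noncomputable section

open Topology

universe u v

namespace Literature.AnabelianGeometry.AbsoluteAnabelian.AbsTopI

namespace CoFreeCompletion

variable {P : Type u} [Group P] [TopologicalSpace P]
  {Q : Type v} [Group Q] [TopologicalSpace Q] [IsTopologicalGroup Q]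
  (ρ : P →ₜ* Q) (Δ : Subgroup P)

/-- `H' ⊆ H ⟹ K_{H'} ⊆ K_H`. [cite: MochizukiAbsTopI2012, §0 p.8] -/
theorem piKer_mono {H H' : CharOpenSubgroup Δ} (h : H' ≤ H) : piKer ρ Δ H' ≤ piKer ρ Δ H := by
  intro p hp
  rw [MonoidHom.mem_ker] at hp ⊢
  change toCoFreeQuot ρ H.toSubgroup p = 1
  rw [← transition_toCoFreeQuot ρ (show H'.toSubgroup ≤ H.toSubgroup from h), show
    toCoFreeQuot ρ H'.toSubgroup p = 1 from hp, map_one]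

/-- The transition map `Π ⧸ K_{H'} → Π ⧸ K_H` for `H' ⊆ H` (continuous). [cite: MochizukiAbsTopI2012, §0 p.8] -/
def piKerTransition {H H' : CharOpenSubgroup Δ} (h : H' ≤ H) : P ⧸ piKer ρ Δ H' →ₜ* P ⧸ piKer ρ Δ H where
  toMonoidHom := QuotientGroup.map _ _ (MonoidHom.id P) (piKer_mono ρ Δ h)
  continuous_toFun := by
    rw [(QuotientGroup.isQuotientMap_mk (piKer ρ Δ H')).continuous_iff]
    exact QuotientGroup.continuous_mk

/-- The transition map on classes. [cite: MochizukiAbsTopI2012, §0 p.8] -/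
@[simp] theorem piKerTransition_mk {H H' : CharOpenSubgroup Δ} (h : H' ≤ H) (p : P) :
    piKerTransition ρ Δ h (p : P ⧸ piKer ρ Δ H') = (p : P ⧸ piKer ρ Δ H) := rfl

variable {ρ Δ} in
/-- The `Π ⧸ K`-coordinates are compatible with the transition maps. [cite: MochizukiAbsTopI2012, §0 p.8] -/
theorem piKerTransition_kerCoord {H H' : CharOpenSubgroup Δ} (h : H' ≤ H) (x : CoFreeCompletion ρ Δ) :
    piKerTransition ρ Δ h (kerCoord H' x) = kerCoord H x := by
  obtain ⟨p, hp⟩ := x.exists_toCoFreeQuot_eq_val H'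
  have hH : toCoFreeQuot ρ H.toSubgroup p = x.val H := by
    rw [← transition_toCoFreeQuot ρ (show H'.toSubgroup ≤ H.toSubgroup from h), hp, x.transition_val]
  rw [kerCoord_eq_mk hp, kerCoord_eq_mk hH, piKerTransition_mk]

variable {ρ Δ} in
/-- Neighbourhood filters in `Π^{Q/co-fr}` (v2 topology): `𝓝 x = ⨅_H (kerCoord H)⁻¹ 𝓝 (kerCoord H x)`.
[cite: MochizukiAbsTopI2012, §0 p.8] -/
theorem nhds_eq (x : CoFreeCompletion ρ Δ) :
    𝓝 x = ⨅ H : CharOpenSubgroup Δ, Filter.comap (kerCoord H) (𝓝 (kerCoord H x)) := by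
  change @nhds _ (⨅ H : CharOpenSubgroup Δ,
      TopologicalSpace.induced (kerCoord (ρ := ρ) (Δ := Δ) H) inferInstance) x = _
  rw [nhds_iInf]
  simp only [nhds_induced]

variable {ρ Δ} in
/-- The family `H ↦ (kerCoord H)⁻¹ 𝓝 (kerCoord H x)` is DIRECTED (smaller `H`, finer filter): the
index semilattice computes the `⨅`. [cite: MochizukiAbsTopI2012, §0 p.8] -/
theorem directed_nhds_kerCoord (x : CoFreeCompletion ρ Δ) :
    Directed (· ≥ ·) fun H : CharOpenSubgroup Δ => Filter.comap (kerCoord H) (𝓝 (kerCoord H x)) := by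
  have hmono : ∀ {H H' : CharOpenSubgroup Δ}, H' ≤ H →
      Filter.comap (kerCoord H') (𝓝 (kerCoord H' x)) ≤ Filter.comap (kerCoord H) (𝓝 (kerCoord H x)) := by
    intro H H' h
    have hfun : (kerCoord (ρ := ρ) (Δ := Δ) H) = piKerTransition ρ Δ h ∘ kerCoord H' :=
      funext fun y => (piKerTransition_kerCoord h y).symm
    rw [hfun, ← Filter.comap_comap]
    refine Filter.comap_mono ?_
    rw [Function.comp_apply]
    exact ((piKerTransition ρ Δ h).continuous.tendsto _).le_comap
  intro H₁ H₂
  exact ⟨H₁ ⊓ H₂, hmono inf_le_left, hmono inf_le_right⟩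

variable {ρ Δ} in
/-- Membership in a neighbourhood filter of `Π^{Q/co-fr}` (v2): `s ∈ 𝓝 x` iff, for SOME index `H` and some
neighbourhood `V` of the `Π ⧸ K_H`-coordinate of `x`, `s` contains all points whose `H`-coordinate lies in
`V`. [cite: MochizukiAbsTopI2012, §0 p.8] -/
theorem mem_nhds_iff [Nonempty (CharOpenSubgroup Δ)] (x : CoFreeCompletion ρ Δ) (s : Set (CoFreeCompletion ρ Δ)) :
    s ∈ 𝓝 x ↔ ∃ (H : CharOpenSubgroup Δ) (V : Set (P ⧸ piKer ρ Δ H)),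
      V ∈ 𝓝 (kerCoord H x) ∧ kerCoord H ⁻¹' V ⊆ s := by
  rw [nhds_eq, Filter.mem_iInf_of_directed (directed_nhds_kerCoord x)]
  simp only [Filter.mem_comap]

end CoFreeCompletion

end Literature.AnabelianGeometry.AbsoluteAnabelian.AbsTopI
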